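import Mathlib
import HarnessLib
import Literature.AlgebraicGeometry.Resolution.BlowupStalkCharts
import Literature.AlgebraicGeometry.Resolution.BlowupChartQuasiRegular

/-!
# One blow-up of an augmentation ideal generated by invariants is Király–Lütkebohmert terminal
(crux stmt-ResolutionOfSingularities-15640 `WildQuotients.WildQuotientResolution`, line `Sketch`;
chain w45c programme «INSTANTIATE T1», stub S4-scheme of `L/w45c/CHAIN.md` v2 §4)

[OURS · L1 W4.5c; NOT a statement of the manuscript.] The local mechanism behind the terminal
models consumed by the cyclic divisorial transfer (`CyclicTransfer.cyclicDivisorialTransfer`,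
p459590): let an automorphism `β` of a scheme `X` lift to `α` on a blow-up `π : V → X` along an
ideal sheaf `J` (`α ≫ π = π ≫ β`, e.g. `IsBlowup.liftAction`), and let `v ∈ V` be fixed by `α`
(so `s = π v` is fixed by `β`). Write `b` for the stalk action of `β` on `𝒪_{X,s}` and `a` for
that of `α` on `𝒪_{V,v}` (the composites `stalkSpecializes ≫ stalkMap` of the crux's divisorial
hypothesis `hdiv`). If the stalk `J_s` of the centre is generated by finitely many `b`-INVARIANT
elements `c_j`, contains every `b r - r`, and each `c_j` lies in the augmentation ideal
`⟨b r - r⟩` (i.e. `J_s` IS the augmentation ideal of `b` and has invariant generators), then the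
augmentation ideal `⟨a y - y : y ∈ 𝒪_{V,v}⟩` of the lifted action is the PRINCIPAL ideal
`J_s · 𝒪_{V,v} = (π^♯ c_j)` of the exceptional divisor (`exists_span_stalkAug_eq`,
`isPrincipal_span_stalkAug`): ONE equivariant blow-up of such a centre reaches the
Király–Lütkebohmert terminal state at every point. (Example: the two-Jordan-block automorphism
`σ = J₂ ⊕ J₂` of `𝔸⁴`, `x₁ ↦ x₁ + x₀`, `x₃ ↦ x₃ + x₂`, whose augmentation ideal `(x₀, x₂)` is
generated by the invariants `x₀, x₂` — programme T of the chain; the single Jordan block `J₄`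
has augmentation ideal `(x₀, x₁, x₂)` with non-invariant generators and is NOT covered.)

Proof. `𝒪_{V,v}` is a localisation of a Rees chart `B = 𝒪_{X,s}[J_s/c_j]` of the blow-up of
`Spec 𝒪_{X,s}` along `J_s` (`IsBlowup.exists_reesChart_stalk`), and `b ≫ π^♯_v = π^♯_v ≫ a`
(cancel the monomorphism `Spec 𝒪_{X,s} → X`; `Scheme.SpecMap_stalkMap_fromSpecStalk`). The
algebra is `span_sub_eq_span_of_chart`: with `t = c_j/1`, a non-zero-divisor generating
`J_s B`, the ring maps `y ↦ [a y]` and `y ↦ [y]` into `𝒪_{V,v}/(t)` agree — on `𝒪_{X,s}` because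
`a (ι r) - ι r = ι (b r - r) ∈ J_s 𝒪 = (t)`, on the generators `c_l/c_j` of `B` because
`t · a(c_l/c_j) = a(ι c_l) = ι c_l = t · (c_l/c_j)` and `t` is regular, hence everywhere
(`B` is generated by the `c_l/c_j`, `eval₂Hom_chartGen_surjective`; ring maps out of a
localisation are determined on `B`) — so `a y - y ∈ (t)`; conversely `t = ι c_j ∈ ⟨ι (b r - r)⟩ =
⟨a (ι r) - ι r⟩`. No chart-level description of the lifted automorphism is needed.
-/

-- single-problem summit: the doubled namespace component `ResolutionOfSingularities` is forced
set_option linter.dupNamespace false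

noncomputable section

open CategoryTheory AlgebraicGeometry TopologicalSpace IsLocalRing
open Literature.AlgebraicGeometry.Resolution

namespace Summit.ResolutionOfSingularities.ResolutionOfSingularities.Theorems.WildQuotientResolution.TerminalBlowup

universe u

/-- **Chart algebra of the terminal blow-up.** Let `c : Fin n → R`, `I = (c)`, and let `A` be
a chart ring of `Bl_I` at `c_i` in abstract form: a structure map `ψ : R → A`, elements `u_j`
with `ψ c_j = ψ c_i · u_j` generating `A` over `R` (`hsurj`), and `ψ(I) ⊆ (ψ c_i)`; let `S` be a
localisation of `A` in which `t = ψ c_i` stays a non-zero-divisor, `ι = (A → S) ∘ ψ`. Let ring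
endomorphisms `b` of `R` and `a` of `S` satisfy `a ∘ ι = ι ∘ b`, `b c_j = c_j` for all `j`,
`b r - r ∈ I` for all `r`, and `c_i ∈ ⟨b r - r⟩`. Then `⟨a y - y : y ∈ S⟩ = (ι c_i)`: the ring
maps `S → S/(t)`, `y ↦ [a y]` and `y ↦ [y]`, agree on `ψ(R)` and on the `u_j` (`t · a u_j =
t · u_j` with `t` regular), hence on `A` and on the localisation `S`; conversely
`ι c_i ∈ ⟨ι (b r - r)⟩ = ⟨a (ι r) - ι r⟩`. [folklore; cf. KiralyLutkebohmert2013, §3] -/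
theorem span_sub_eq_span_of_chart {R A S : Type u} [CommRing R] [CommRing A] [CommRing S]
    {n : ℕ} (c : Fin n → R) (i : Fin n) (ψ : R →+* A) (u : {j : Fin n // j ≠ i} → A)
    (hsurj : Function.Surjective (MvPolynomial.eval₂Hom ψ u))
    (hu : ∀ j, ψ (c j.1) = ψ (c i) * u j)
    (hψI : ∀ r ∈ Ideal.span (Set.range c), ψ r ∈ Ideal.span {ψ (c i)})
    [Algebra A S] (M : Submonoid A) [IsLocalization M S]
    (hnzd : algebraMap A S (ψ (c i)) ∈ nonZeroDivisors S)
    (ι : R →+* S) (hι : ∀ r, algebraMap A S (ψ r) = ι r)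
    (b : R →+* R) (a : S →+* S) (hab : ∀ r, a (ι r) = ι (b r))
    (hfix : ∀ j, b (c j) = c j) (haug : ∀ r, b r - r ∈ Ideal.span (Set.range c))
    (hci : c i ∈ Ideal.span (Set.range fun r : R => b r - r)) :
    Ideal.span (Set.range fun y : S => a y - y) = Ideal.span {ι (c i)} := by
  classical
  set t : S := ι (c i) with ht
  have ht' : algebraMap A S (ψ (c i)) = t := hι (c i)
  have htnzd : t ∈ nonZeroDivisors S := ht' ▸ hnzd
  -- `a t = t`
  have hat : a t = t := by rw [ht, hab, hfix]
  apply le_antisymm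
  · -- `⊆`: the ring maps `S → S/(t)`, `y ↦ [a y]` and `y ↦ [y]`, agree
    let mk : S →+* S ⧸ Ideal.span ({t} : Set S) := Ideal.Quotient.mk _
    have hagree : mk.comp a = mk := by
      apply IsLocalization.ringHom_ext M (S := S)
      -- agree on the chart ring `A = R[c_j/c_i : j]`: check on `R` and on the `c_j/c_i`
      have key : ((mk.comp a).comp (algebraMap A S)).comp (MvPolynomial.eval₂Hom ψ u) =
          (mk.comp (algebraMap A S)).comp (MvPolynomial.eval₂Hom ψ u) := by
        refine MvPolynomial.ringHom_ext (fun r => ?_) (fun j => ?_)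
        · -- constants: `a (ι r) - ι r = ι (b r - r) ∈ ι(I) S ⊆ (t)`
          simp only [RingHom.comp_apply, MvPolynomial.eval₂Hom_C]
          rw [hι, hab, Ideal.Quotient.eq, Ideal.mem_span_singleton]
          obtain ⟨w, hw⟩ := Ideal.mem_span_singleton'.mp (hψI _ (haug r))
          refine ⟨algebraMap A S w, ?_⟩
          have := congrArg (algebraMap A S) hw
          rw [map_mul, ht', map_sub, map_sub, hι, hι] at this
          rw [mul_comm, this]
        · -- generators `u_j = c_j / c_i`: `t · a(u_j) = a(ι c_j) = ι c_j = t · u_j`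
          simp only [RingHom.comp_apply, MvPolynomial.eval₂Hom_X']
          congr 1
          have hej : t * algebraMap A S (u j) = ι (c j.1) := by
            rw [← ht', ← map_mul, ← hu j, hι]
          have h1 : t * a (algebraMap A S (u j)) = t * algebraMap A S (u j) := by
            rw [hej, ← hat, ← map_mul, hej, hab, hfix]
          exact (mul_cancel_left_mem_nonZeroDivisors htnzd).mp h1
      exact RingHom.ext fun z => by
        obtain ⟨P, rfl⟩ := hsurj z
        exact RingHom.congr_fun key P
    rw [Ideal.span_le]
    rintro _ ⟨y, rfl⟩
    have hy : mk (a y) = mk y := by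
      rw [← RingHom.comp_apply, hagree]
    exact (Ideal.Quotient.eq.mp hy)
  · -- `⊇`: `c_i` is in the augmentation ideal of `b`, and `ι (b r - r) = a (ι r) - ι r`
    rw [Ideal.span_singleton_le_iff_mem, ht]
    have h1 : ι (c i) ∈ (Ideal.span (Set.range fun r : R => b r - r)).map ι :=
      Ideal.mem_map_of_mem ι hci
    rw [Ideal.map_span] at h1
    refine Ideal.span_mono ?_ h1
    rintro _ ⟨_, ⟨r, rfl⟩, rfl⟩
    refine ⟨ι r, ?_⟩
    change a (ι r) - ι r = ι (b r - r)
    rw [map_sub, hab]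

/-- **One blow-up of an augmentation ideal with invariant generators is terminal (stalk form).**
Let `π : V → X` be a blow-up along the ideal sheaf `J` (`IsBlowup π J`), `α : V → V` and
`β : X → X` with `α ≫ π = π ≫ β`, and `v ∈ V` with `α v = v` (then `β` fixes `s = π v`). Let
`c : Fin n → 𝒪_{X,s}` generate the stalk `J_s` (`stalkIdeal`), and suppose that for the stalk
action `b = stalkSpecializes ≫ β^♯_s` of `β`: `b c_j = c_j`, `b r - r ∈ (c)` for all `r`, and
`c_j ∈ ⟨b r - r⟩` for all `j`. Then for some `j` the augmentation ideal of the stalk action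
`a = stalkSpecializes ≫ α^♯_v` of `α` on `𝒪_{V,v}` is `⟨a y - y⟩ = (π^♯_v c_j)`.
Proof: `𝒪_{V,v}` is a localisation of the Rees chart `𝒪_{X,s}[J_s/c_j]`
(`IsBlowup.exists_reesChart_stalk`), `b ≫ π^♯_v = π^♯_v ≫ a` by cancelling the monomorphism
`Spec 𝒪_{X,s} → X` (`Scheme.SpecMap_stalkMap_fromSpecStalk`,
`Scheme.SpecMap_stalkSpecializes_fromSpecStalk`), and `span_sub_eq_span_of_chart` applies
(`eval₂Hom_chartGen_surjective`, `reesChartBase_apply_eq_mul_chartGen`,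
`reesChartBase_mem_span_of_mem`, `reesChartBase_mem_nonZeroDivisors`).
[cite: StacksProject, Tag 0804] [folklore] -/
theorem exists_span_stalkAug_eq {V X : Scheme.{u}} {π : V ⟶ X} {J : X.IdealSheafData}
    (hπ : IsBlowup π J) {α : V ⟶ V} {β : X ⟶ X} (hequiv : α ≫ π = π ≫ β)
    (v : V) (hv : α.base v = v) {n : ℕ} (c : Fin n → X.presheaf.stalk (π.base v))
    (hc : Ideal.span (Set.range c) = stalkIdeal J (π.base v))
    (hb : ∀ hs : β.base (π.base v) = π.base v,
      (∀ j, (X.presheaf.stalkSpecializes (specializes_of_eq hs) ≫ β.stalkMap (π.base v)).hom (c j) =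
          c j) ∧
      (∀ r, (X.presheaf.stalkSpecializes (specializes_of_eq hs) ≫ β.stalkMap (π.base v)).hom r - r ∈
          Ideal.span (Set.range c)) ∧
      (∀ j, c j ∈ Ideal.span (Set.range fun r =>
          (X.presheaf.stalkSpecializes (specializes_of_eq hs) ≫ β.stalkMap (π.base v)).hom r - r))) :
    ∃ j, Ideal.span (Set.range fun y =>
        (V.presheaf.stalkSpecializes (specializes_of_eq hv) ≫ α.stalkMap v).hom y - y) =
      Ideal.span {(π.stalkMap v).hom (c j)} := by
  classical
  -- `β` fixes `s = π v`
  have hs : β.base (π.base v) = π.base v := by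
    have h := congrArg (fun f : V ⟶ X => f.base v) hequiv
    simp only [Scheme.Hom.comp_base, TopCat.coe_comp, Function.comp_apply] at h
    rw [hv] at h
    exact h.symm
  obtain ⟨hfix, haug, hcmem⟩ := hb hs
  set aH := V.presheaf.stalkSpecializes (specializes_of_eq hv) ≫ α.stalkMap v with haH
  set bH := X.presheaf.stalkSpecializes (specializes_of_eq hs) ≫ β.stalkMap (π.base v) with hbH
  -- the stalk actions are intertwined by `π^♯_v`: cancel the monomorphism `Spec 𝒪_{X,s} → X`
  have hkeya : Spec.map aH ≫ V.fromSpecStalk v = V.fromSpecStalk v ≫ α := by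
    rw [haH, Spec.map_comp, Category.assoc, Scheme.SpecMap_stalkSpecializes_fromSpecStalk,
      Scheme.SpecMap_stalkMap_fromSpecStalk]
  have hkeyb : Spec.map bH ≫ X.fromSpecStalk (π.base v) = X.fromSpecStalk (π.base v) ≫ β := by
    rw [hbH, Spec.map_comp, Category.assoc, Scheme.SpecMap_stalkSpecializes_fromSpecStalk,
      Scheme.SpecMap_stalkMap_fromSpecStalk]
  have hcompat : bH ≫ π.stalkMap v = π.stalkMap v ≫ aH := by
    apply Spec.map_injective
    rw [← cancel_mono (X.fromSpecStalk (π.base v))]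
    simp only [Spec.map_comp, Category.assoc, hkeyb, Scheme.SpecMap_stalkMap_fromSpecStalk,
      Scheme.SpecMap_stalkMap_fromSpecStalk_assoc]
    rw [reassoc_of% hkeya, hequiv]
  have hab : ∀ r, aH.hom ((π.stalkMap v).hom r) = (π.stalkMap v).hom (bH.hom r) := fun r => by
    rw [← CommRingCat.comp_apply, ← CommRingCat.comp_apply, hcompat]
  -- `𝒪_{V,v}` is a localisation of a Rees chart of `Bl_{J_s} Spec 𝒪_{X,s}`
  obtain ⟨j, 𝔴, χ, hχ, hloc, -⟩ := hπ.exists_reesChart_stalk v c hc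
  refine ⟨j, ?_⟩
  letI := χ.toAlgebra
  haveI : IsLocalization 𝔴.asIdeal.primeCompl (V.presheaf.stalk v) := hloc
  have hχ' : ∀ r, algebraMap (chartRing c j) (V.presheaf.stalk v) (chartBase c j r) =
      (π.stalkMap v).hom r := fun r => by
    rw [RingHom.algebraMap_toAlgebra]
    exact hχ r
  exact span_sub_eq_span_of_chart c j (chartBase c j) (fun j' => chartGen c j j'.1)
    (eval₂Hom_chartGen_surjective c j) (fun j' => reesChartBase_apply_eq_mul_chartGen c j j'.1)
    (fun r hr => reesChartBase_mem_span_of_mem c j hr) 𝔴.asIdeal.primeCompl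
    (IsLocalization.nonZeroDivisors_le_comap 𝔴.asIdeal.primeCompl _
      (reesChartBase_mem_nonZeroDivisors (c j) (Ideal.mem_span_range_self (f := c) (x := j))))
    (π.stalkMap v).hom hχ' bH.hom aH.hom hab hfix haug (hcmem j)

/-- **The Király–Lütkebohmert terminal state after one blow-up** (the `hdiv` clause of
`CyclicTransfer.cyclicDivisorialTransfer` / `CyclicDivisorialModelsLE`, pointwise): under the
hypotheses of `exists_span_stalkAug_eq`, the augmentation ideal
`⟨(stalkSpecializes ≫ α^♯_v) y - y : y ∈ 𝒪_{V,v}⟩` of the lifted automorphism at the fixed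
point `v` is principal. [folklore] -/
theorem isPrincipal_span_stalkAug {V X : Scheme.{u}} {π : V ⟶ X} {J : X.IdealSheafData}
    (hπ : IsBlowup π J) {α : V ⟶ V} {β : X ⟶ X} (hequiv : α ≫ π = π ≫ β)
    (v : V) (hv : α.base v = v) {n : ℕ} (c : Fin n → X.presheaf.stalk (π.base v))
    (hc : Ideal.span (Set.range c) = stalkIdeal J (π.base v))
    (hb : ∀ hs : β.base (π.base v) = π.base v,
      (∀ j, (X.presheaf.stalkSpecializes (specializes_of_eq hs) ≫ β.stalkMap (π.base v)).hom (c j) =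
          c j) ∧
      (∀ r, (X.presheaf.stalkSpecializes (specializes_of_eq hs) ≫ β.stalkMap (π.base v)).hom r - r ∈
          Ideal.span (Set.range c)) ∧
      (∀ j, c j ∈ Ideal.span (Set.range fun r =>
          (X.presheaf.stalkSpecializes (specializes_of_eq hs) ≫ β.stalkMap (π.base v)).hom r - r))) :
    (Ideal.span (Set.range fun y =>
        (V.presheaf.stalkSpecializes (specializes_of_eq hv) ≫ α.stalkMap v).hom y - y)).IsPrincipal := by
  obtain ⟨j, hj⟩ := exists_span_stalkAug_eq hπ hequiv v hv c hc hb
  rw [hj]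
  exact ⟨⟨(π.stalkMap v).hom (c j), rfl⟩⟩

/-- **The lifted action on the chart generators** (tower bookkeeping, item (5) of the chain's
R1a-TOWER memo): in the abstract chart setting of `span_sub_eq_span_of_chart` (`ψ : R → A` with
generators `u_l`, `ψ c_l = ψ c_i · u_l`, `ψ(I) ⊆ (ψ c_i)`; `S` a localisation of `A` with
`t = ψ c_i` regular; `a ∘ ι = ι ∘ b`, `b c_i = c_i`), if `b` maps the generator `c_l` into
`I = (c)` then the action of `a` on the chart generator `u_l = c_l / c_i` is computed INSIDE the
chart ring: `a (u_l) = w` for any `w ∈ A` with `ψ (b c_l) = ψ c_i · w` (and such a `w` exists).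
Proof: `t · a(u_l) = a(ι c_l) = ι (b c_l) = t · w` and `t` is a non-zero-divisor. This is the
dictionary that lets a SECOND blow-up read the lifted action on the first blow-up's charts.
[folklore] -/
theorem stalkAction_chartGen_of_chart {R A S : Type u} [CommRing R] [CommRing A] [CommRing S]
    {n : ℕ} (c : Fin n → R) (i : Fin n) (ψ : R →+* A) (u : {j : Fin n // j ≠ i} → A)
    (hu : ∀ j, ψ (c j.1) = ψ (c i) * u j)
    (hψI : ∀ r ∈ Ideal.span (Set.range c), ψ r ∈ Ideal.span {ψ (c i)})
    [Algebra A S] (hnzd : algebraMap A S (ψ (c i)) ∈ nonZeroDivisors S)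
    (ι : R →+* S) (hι : ∀ r, algebraMap A S (ψ r) = ι r)
    (b : R →+* R) (a : S →+* S) (hab : ∀ r, a (ι r) = ι (b r))
    (hfix : b (c i) = c i) (l : {j : Fin n // j ≠ i})
    (hl : b (c l.1) ∈ Ideal.span (Set.range c)) :
    ∃ w : A, ψ (b (c l.1)) = ψ (c i) * w ∧
      ∀ w' : A, ψ (b (c l.1)) = ψ (c i) * w' →
        a (algebraMap A S (u l)) = algebraMap A S w' := by
  obtain ⟨w, hw⟩ := Ideal.mem_span_singleton'.mp (hψI _ hl)
  refine ⟨w, by rw [← hw, mul_comm], fun w' hw' => ?_⟩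
  set t : S := algebraMap A S (ψ (c i)) with ht
  have hat : a t = t := by rw [ht, hι, hab, hfix]
  have h1 : t * a (algebraMap A S (u l)) = t * algebraMap A S w' := by
    rw [← hat, ← map_mul, ← map_mul, ← hu l, hι, hab, ← hι, hw', map_mul, hat]
  exact (mul_cancel_left_mem_nonZeroDivisors hnzd).mp h1

end Summit.ResolutionOfSingularities.ResolutionOfSingularities.Theorems.WildQuotientResolution.TerminalBlowup

end
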